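import Summits.CriticalPhenomena.PercolationContinuityZ3.Theorems.PercNearOneGluingNoHeavyLowerTailAntitheticPendant
import HarnessLib

/-!
# `NoHeavyLowerTail` (stmt-CriticalPhenomena-4575) — antithetic cluster pairs: the ONE-MARKER ONE-SIDED AUGMENTATION `OS₁` IS A PENDANT SUM
# (prim-hp-2 gen 45; HOME/THEOREM-OS-augmentation.md §0 remark, §5 (O3))

Support file (`--supports stmt-CriticalPhenomena-4575`, hull-port prover `prim-hp-2`, gen 45).  No definitions, no named facts, no sorries.

`OS₁` (THEOREM-Cprime §11 / THEOREM-OS §0 with one marked vertex): for a pair set `E`, a vertex `u` and a marker pair `m = uℓ` at a fresh leaf `ℓ`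
(`ℓ ≠ s`, `ℓ` meets only loops of `E`), `OS₁(F,G) := Σ_{ω ∈ tset_E(R,X)} (F(C) − F(L C′))(G(C) − G(L C′))` with `C, C′` the red / blue edge clusters of
`s` on `E` and `L = Pendant.liftSet s u m` ("attach `m` iff `u` is seen").  It is a building block of the one-tail reduction of CONJECTURE Δ2.
* `Antithetic.OSOne.sum_eq_tsum_insert` — **`OS₁ = T_{E ∪ {m}}(R, X)`**: over `E ∪ {m}` the colourings with `m` blue contribute `Δ(C, L C′)`, those
  with `m` red `Δ(L C, C′)` (`Pendant.delta_insert`, `Pendant.tset_insert`), and the reflection `ω ↦ ωᶜ ∆ {m}` exchanges the two kinds of terms.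
* `Antithetic.OSOne.nonneg_of_good` — hence `OS₁ ≥ 0` on every pair set that is good for `(R, X)` (pendant-edge lemma `Pendant.good_insert`); with
  `Cyc.cycle_tsum_nonneg` this is LEMMA OS₁ of THEOREM-Cprime §11 on cycles as a tree theorem, and the same on every machine-good class.
[cite: VandenbergHaggstromKahn2005, §1 p. 3 (open cluster `C_s`)]
-/

noncomputable section

namespace Summit.CriticalPhenomena.PercolationContinuityZ3.Theorems

open Literature.Probability.Percolation
open scoped Classical symmDiff

namespace Antithetic

namespace OSOne

variable {V : Type*}

/-- `(ωᶜ ∆ D)ᶜ = ω ∆ D`. [folklore] -/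
theorem compl_compl_symmDiff (ω D : Set (Sym2 V)) : (ωᶜ ∆ D)ᶜ = ω ∆ D := by
  ext h
  simp only [Set.mem_compl_iff, Set.mem_symmDiff]
  tauto

variable [Fintype V] {E : Set (Sym2 V)} {s u ℓ : V}

/-- The constraint set is closed under the colour swap. [this work] -/
theorem compl_mem_tset {R X : Set V} {ω : Set (Sym2 V)} (h : ω ∈ Peel.tset E s R X) : ωᶜ ∈ Peel.tset E s R X := by
  rw [Peel.mem_tset] at h ⊢
  rw [compl_compl]
  exact ⟨fun r hr hh => h.1 r hr ⟨hh.2, hh.1⟩, fun x hx => ⟨(h.2 x hx).2, (h.2 x hx).1⟩⟩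

/-- **`OS₁ = T_{E ∪ {m}}`.** [this work] -/
theorem sum_eq_tsum_insert (hℓ : ∀ f ∈ E, ℓ ∈ f → f.IsDiag) (huℓ : u ≠ ℓ) (hsℓ : s ≠ ℓ) (R X : Set V) (hX : ℓ ∉ X)
    (F G : Set (Sym2 V) → ℝ) :
    ∑ ω ∈ Peel.tset E s R X,
        (F (openEdgeCluster (ω ∩ E) s) - F (Pendant.liftSet s u s(u, ℓ) (openEdgeCluster (ωᶜ ∩ E) s))) *
          (G (openEdgeCluster (ω ∩ E) s) - G (Pendant.liftSet s u s(u, ℓ) (openEdgeCluster (ωᶜ ∩ E) s))) =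
      Peel.tsum F G (insert s(u, ℓ) E) s R X := by
  have he : s(u, ℓ) ∉ E := Pendant.pair_not_mem E u ℓ hℓ huℓ
  unfold Peel.tsum
  rw [Pendant.tset_insert hℓ huℓ hsℓ R X hX]
  set S := Peel.tset E s R X with hS
  set A : Set (Sym2 V) → ℝ := fun ω =>
    (F (openEdgeCluster (ω ∩ E) s) - F (Pendant.liftSet s u s(u, ℓ) (openEdgeCluster (ωᶜ ∩ E) s))) *
      (G (openEdgeCluster (ω ∩ E) s) - G (Pendant.liftSet s u s(u, ℓ) (openEdgeCluster (ωᶜ ∩ E) s))) with hA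
  set B : Set (Sym2 V) → ℝ := fun ω =>
    (F (Pendant.liftSet s u s(u, ℓ) (openEdgeCluster (ω ∩ E) s)) - F (openEdgeCluster (ωᶜ ∩ E) s)) *
      (G (Pendant.liftSet s u s(u, ℓ) (openEdgeCluster (ω ∩ E) s)) - G (openEdgeCluster (ωᶜ ∩ E) s)) with hB
  have hdelta : ∀ ω ∈ S, Peel.delta F G (insert s(u, ℓ) E) s ω = if s(u, ℓ) ∈ ω then B ω else A ω := fun ω _ => by
    rw [Pendant.delta_insert hℓ huℓ hsℓ]
  rw [Finset.sum_congr rfl hdelta, Finset.sum_ite, ← Finset.sum_filter_add_sum_filter_not S (fun ω => s(u, ℓ) ∈ ω) A]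
  -- it remains to identify the `m`-red halves: the reflection `φ ω = ωᶜ ∆ {m}` maps the `m`-red colourings onto themselves and `B` onto `A`
  suffices h : ∑ ω ∈ S.filter (fun ω => s(u, ℓ) ∈ ω), A ω = ∑ ω ∈ S.filter (fun ω => s(u, ℓ) ∈ ω), B ω by rw [h]
  have hmemφ : ∀ ω ∈ S.filter (fun ω => s(u, ℓ) ∈ ω), ωᶜ ∆ {s(u, ℓ)} ∈ S.filter (fun ω => s(u, ℓ) ∈ ω) := by
    intro ω hω
    rw [Finset.mem_filter] at hω ⊢
    refine ⟨?_, ?_⟩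
    · rw [hS, Peel.mem_tset, Pendant.symmDiff_pair_inter he, compl_compl_symmDiff, Pendant.symmDiff_pair_inter he]
      have h1 := hω.1
      rw [hS, Peel.mem_tset] at h1
      exact ⟨fun r hr hh => h1.1 r hr ⟨hh.2, hh.1⟩, fun x hx => ⟨(h1.2 x hx).2, (h1.2 x hx).1⟩⟩
    · rw [Set.mem_symmDiff, Set.mem_singleton_iff]
      exact Or.inr ⟨rfl, fun h => h hω.2⟩
  have hinv : ∀ ω : Set (Sym2 V), (ωᶜ ∆ {s(u, ℓ)})ᶜ ∆ {s(u, ℓ)} = ω := fun ω => by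
    rw [compl_compl_symmDiff, symmDiff_symmDiff_cancel_right]
  symm
  refine Finset.sum_nbij' (fun ω => ωᶜ ∆ {s(u, ℓ)}) (fun ω => ωᶜ ∆ {s(u, ℓ)}) hmemφ hmemφ (fun ω _ => hinv ω) (fun ω _ => hinv ω)
    (fun ω _ => ?_)
  simp only [hA, hB, Pendant.symmDiff_pair_inter he, compl_compl_symmDiff]
  ring

/-- **`OS₁ ≥ 0` on good pair sets.** [this work] -/
theorem nonneg_of_good (hℓ : ∀ f ∈ E, ℓ ∈ f → f.IsDiag) (huℓ : u ≠ ℓ) (hsℓ : s ≠ ℓ) (R X : Set V) (hX : ℓ ∉ X)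
    (hgood : ∀ F G : Set (Sym2 V) → ℝ, Monotone F → Monotone G → 0 ≤ Peel.tsum F G E s R X)
    {F G : Set (Sym2 V) → ℝ} (hF : Monotone F) (hG : Monotone G) :
    0 ≤ ∑ ω ∈ Peel.tset E s R X,
        (F (openEdgeCluster (ω ∩ E) s) - F (Pendant.liftSet s u s(u, ℓ) (openEdgeCluster (ωᶜ ∩ E) s))) *
          (G (openEdgeCluster (ω ∩ E) s) - G (Pendant.liftSet s u s(u, ℓ) (openEdgeCluster (ωᶜ ∩ E) s))) := by
  rw [sum_eq_tsum_insert hℓ huℓ hsℓ R X hX F G]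
  exact Pendant.good_insert hℓ huℓ hsℓ R X hX hgood hF hG

end OSOne

end Antithetic

end Summit.CriticalPhenomena.PercolationContinuityZ3.Theorems
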